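import Summits.FinalStateConjecture.FinalStateConjecture.Theorems.SwallowTheDatumSubdataDevelopmentsEmbedSkeleton
import Summits.FinalStateConjecture.FinalStateConjecture.Theorems.SwallowTheDatumSubdataDevelopmentsEmbedDoD
import Summits.FinalStateConjecture.FinalStateConjecture.Theorems.SwallowTheDatumSubdataDevelopmentsEmbedHmaxGlue
import Literature.Geometry.Lorentzian.MaximalCommonDevelopment
import Literature.Geometry.Lorentzian.CauchyProblemLocalUniqueness

/-!
# Route SwallowTheDatum · item `SubdataDevelopmentsEmbed` (stmt-FinalStateConjecture-10053) —
# the item from LOCAL THEORY + DOMAIN OF DEPENDENCE + NO CORRESPONDING BOUNDARY POINTS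

Second skeleton. `subdataDevelopmentsEmbed_of_skeleton` reduced the item to (1) local geometric
uniqueness, (2) the domain-of-dependence sub-development and (3) "a maximal relative common
sub-development of a maximal development is everything". Since then (2) was reduced to the bare
causal statement "the sub-datum is a Cauchy hypersurface of an open connected region of the
development" (`hdod_of_cauchyRegion`), and (3) to the relative "no corresponding boundary points"
theorem alone (`top_of_maximal_relCGHD_of_ncb`, the gluing `M ∪_ψ M'` being constructed in
`Literature/…/RelativeDevelopmentGluing*.lean`). Composing:

* `subdataDevelopmentsEmbed_of_localTheory_of_cauchyRegion_of_ncb` — **the item follows from**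
  (a) `hloc`: absolute local geometric uniqueness for the vacuum Einstein equations in its printed
  symmetric form (Choquet-Bruhat–Geroch 1969, Thm. 2; Sbierski 2016, Thm. 2.4(ii) — a PDE fact to
  be vendored); (b) `hc`: for every vacuum Cauchy development `𝒟` of data on `X` and every smooth
  open embedding `Φ : N → X` with injective differentials, `ι(Φ N)` is a Cauchy hypersurface of
  some open connected `V ⊆ M` (Hawking–Ellis 1973, Prop. 6.6.3 / §6.5: the Cauchy development of a
  piece of a Cauchy hypersurface — causal theory); (c) `hncb`: a relative common sub-development
  of a development of the sub-datum and a MAXIMAL development of the datum that admits no proper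
  extension has no corresponding boundary points (Sbierski 2016, Thm. 3.5 = arXiv Thm. 12,
  relative form — causal theory plus one more application of (a)).

Pure composition; no definition; the only named fact is the registered local-uniqueness
statement used by the last corollary.
-/

noncomputable section

open Function Set Filter Topology TopologicalSpace
open scoped Manifold ContDiff Topology

namespace Summit.FinalStateConjecture.FinalStateConjecture.Theorems

open Literature.Geometry.Lorentzian SubdataDevelopmentsEmbed

/-- **`SubdataDevelopmentsEmbed` from local theory, the domain of dependence and the relative
"no corresponding boundary points" theorem** (see the module docstring for (a), (b), (c); the
remaining steps — relative rigidity and injectivity, the maximal relative common sub-development,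
re-basing along `Φ`, the smoothness of the normal, the constraints, the relative gluing and its
Cauchy hypersurface — are theorems of the tree). [cite: Sbierski2016AHP, Thm. 2.4(ii), Thm. 3.5 and §3.3] -/
theorem subdataDevelopmentsEmbed_of_localTheory_of_cauchyRegion_of_ncb
    (hloc : ∀ (N : Type) [TopologicalSpace N] [ChartedSpace E3 N] [IsManifold (𝓡 3) ∞ N]
      [ConnectedSpace N] (D₁ : InitialDataSet (𝓡 3) N) (𝒟₁ 𝒟₂ : VacuumCauchyDevelopment D₁),
      ∃ 𝒰 : VacuumCauchyDevelopment D₁,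
        𝒰.toCauchyDevelopment.EmbedsInto 𝒟₁.toCauchyDevelopment ∧
          𝒰.toCauchyDevelopment.EmbedsInto 𝒟₂.toCauchyDevelopment)
    (hc : ∀ (X : Type) [TopologicalSpace X] [ChartedSpace E3 X] [IsManifold (𝓡 3) ∞ X]
      [T2Space X] [SecondCountableTopology X] [ConnectedSpace X] (D : InitialDataSet (𝓡 3) X)
      (𝒟 : VacuumCauchyDevelopment D) (N : Type) [TopologicalSpace N] [ChartedSpace E3 N]
      [IsManifold (𝓡 3) ∞ N] [ConnectedSpace N] (Φ : N → X)
      (hΦ : ContMDiff (𝓡 3) (𝓡 3) (∞ + 1) Φ) (hΦ' : ∀ u, Injective (mfderiv (𝓡 3) (𝓡 3) Φ u)),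
      IsOpenEmbedding Φ →
      ∃ V : Opens 𝒟.carrier, IsConnected (V : Set 𝒟.carrier) ∧ (∀ u, 𝒟.embed (Φ u) ∈ V) ∧
        (𝒟.metric.restrict PseudoRiemannianMetric.contMDiff_restrict_holds V).IsCauchyHypersurface
          (𝒟.timeOrientation.restrict PseudoRiemannianMetric.contMDiff_restrict_holds
            𝒟.timeOrientation.contMDiff_restrict_holds V) (Subtype.val ⁻¹' range (𝒟.embed ∘ Φ)))
    (hncb : ∀ (X : Type) [TopologicalSpace X] [ChartedSpace E3 X] [IsManifold (𝓡 3) ∞ X]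
      [T2Space X] [SecondCountableTopology X] [ConnectedSpace X] (D : InitialDataSet (𝓡 3) X)
      (𝒟 : VacuumCauchyDevelopment D), 𝒟.IsMaximal →
      ∀ (N : Type) [TopologicalSpace N] [ChartedSpace E3 N] [IsManifold (𝓡 3) ∞ N]
      [ConnectedSpace N] (Φ : N → X) (hΦ : ContMDiff (𝓡 3) (𝓡 3) (∞ + 1) Φ)
      (hΦ' : ∀ u, Injective (mfderiv (𝓡 3) (𝓡 3) Φ u)), IsOpenEmbedding Φ →
      ∀ (𝒟' : VacuumCauchyDevelopment (D.comap Φ hΦ hΦ')) (U : Opens 𝒟'.carrier)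
        (ψ : 𝒟'.carrier → 𝒟.carrier),
        ((∀ u, 𝒟'.embed u ∈ U) ∧ IsConnected (U : Set 𝒟'.carrier) ∧
        (𝒟'.metric.restrict PseudoRiemannianMetric.contMDiff_restrict_holds U).IsCauchyHypersurface
          (𝒟'.timeOrientation.restrict PseudoRiemannianMetric.contMDiff_restrict_holds
            𝒟'.timeOrientation.contMDiff_restrict_holds U) (Subtype.val ⁻¹' range 𝒟'.embed) ∧
        ContMDiffOn (𝓡 4) (𝓡 4) ∞ ψ U ∧
        (∀ p ∈ U, pullbackBilin (I := 𝓡 4) (I' := 𝓡 4) ψ 𝒟.metric.val p = 𝒟'.metric.val p) ∧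
        (∀ p ∈ U, 𝒟.timeOrientation.IsFutureDirected
          (mfderiv (𝓡 4) (𝓡 4) ψ p (𝒟'.timeOrientation.vectorField p))) ∧
        ψ ∘ 𝒟'.embed = 𝒟.embed ∘ Φ) →
        (∀ (U' : Opens 𝒟'.carrier) (ψ' : 𝒟'.carrier → 𝒟.carrier),
          ((∀ u, 𝒟'.embed u ∈ U') ∧ IsConnected (U' : Set 𝒟'.carrier) ∧
          (𝒟'.metric.restrict PseudoRiemannianMetric.contMDiff_restrict_holds
              U').IsCauchyHypersurface
            (𝒟'.timeOrientation.restrict PseudoRiemannianMetric.contMDiff_restrict_holds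
              𝒟'.timeOrientation.contMDiff_restrict_holds U') (Subtype.val ⁻¹' range 𝒟'.embed) ∧
          ContMDiffOn (𝓡 4) (𝓡 4) ∞ ψ' U' ∧
          (∀ p ∈ U', pullbackBilin (I := 𝓡 4) (I' := 𝓡 4) ψ' 𝒟.metric.val p = 𝒟'.metric.val p) ∧
          (∀ p ∈ U', 𝒟.timeOrientation.IsFutureDirected
            (mfderiv (𝓡 4) (𝓡 4) ψ' p (𝒟'.timeOrientation.vectorField p))) ∧
          ψ' ∘ 𝒟'.embed = 𝒟.embed ∘ Φ) →
          U ≤ U' → EqOn ψ ψ' U → U' = U) →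
        ∀ p ∈ frontier (U : Set 𝒟'.carrier), ∀ q : 𝒟.carrier,
          ¬ ClusterPt q (map ψ (𝓝[(U : Set 𝒟'.carrier)] p))) :
    Summit.FinalStateConjecture.FinalStateConjecture.Theses.SwallowTheDatum.SubdataDevelopmentsEmbed :=
  subdataDevelopmentsEmbed_of_skeleton hloc (hdod_of_cauchyRegion hc)
    fun X _ _ _ _ _ _ D 𝒟 h𝒟 N _ _ _ _ Φ hΦ hΦ' hΦo 𝒟' U ψ hP hUmax ↦
      top_of_maximal_relCGHD_of_ncb 𝒟' 𝒟 h𝒟 hΦo.injective U ψ hP hUmax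
        (hncb X D 𝒟 h𝒟 N Φ hΦ hΦ' hΦo 𝒟' U ψ hP hUmax)

/-! ### Local uniqueness in the shape displayed by the absolute programme -/

/-- **The symmetric printed form of local geometric uniqueness from the realised form** used as
input `hlocal` by the absolute programme (`Literature/…/DevelopmentGluing.lean`,
`MGHDExistenceReduction.lean`: any two vacuum Cauchy developments `𝒟₁`, `𝒟₂` of the same data
have a common globally hyperbolic development `U ⊆ M₁`, `CauchyDevelopment.IsCommonDevelopment`):
the restricted development `(U, g₁|_U, ι₁)` (`VacuumCauchyDevelopment.restrict`, the normal being
smooth along the data embedding, `DataEmbedding.mdifferentiableAt_embed_normal`) embeds into `𝒟₁`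
by the inclusion and into `𝒟₂` by Sbierski's Lemma 9 (`IsCommonDevelopment.restrict_embedsInto`).
So whichever of the two shapes of Choquet-Bruhat–Geroch's Theorem 2 / Sbierski's Theorem 2.4(ii)
is vendored, hypothesis `hloc` of the skeletons is available. [cite: Sbierski2016AHP, §2, Def. 2.4 and Thm. 2.4(ii)] -/
theorem hloc_of_isCommonDevelopment
    (hlocal : ∀ (N : Type) [TopologicalSpace N] [ChartedSpace E3 N] [IsManifold (𝓡 3) ∞ N]
      [ConnectedSpace N] (D₁ : InitialDataSet (𝓡 3) N) (𝒟₁ 𝒟₂ : VacuumCauchyDevelopment D₁),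
      ∃ U : Opens 𝒟₁.carrier, 𝒟₁.toCauchyDevelopment.IsCommonDevelopment 𝒟₂.toDataEmbedding U)
    (N : Type) [TopologicalSpace N] [ChartedSpace E3 N] [IsManifold (𝓡 3) ∞ N]
    [ConnectedSpace N] (D₁ : InitialDataSet (𝓡 3) N) (𝒟₁ 𝒟₂ : VacuumCauchyDevelopment D₁) :
    ∃ 𝒰 : VacuumCauchyDevelopment D₁,
      𝒰.toCauchyDevelopment.EmbedsInto 𝒟₁.toCauchyDevelopment ∧
        𝒰.toCauchyDevelopment.EmbedsInto 𝒟₂.toCauchyDevelopment := by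
  obtain ⟨U, hU⟩ := hlocal N D₁ 𝒟₁ 𝒟₂
  have hν : ∀ x, MDifferentiableAt (𝓡 3) (𝓡 4).tangent
      (fun x ↦ (Bundle.TotalSpace.mk' (EuclideanSpace ℝ (Fin 4)) (𝒟₁.embed x) (𝒟₁.normal x) :
        TangentBundle (𝓡 4) 𝒟₁.carrier)) x := fun x ↦
    𝒟₁.toDataEmbedding.mdifferentiableAt_embed_normal x
  have hconn : IsConnected (U : Set 𝒟₁.carrier) := hU.isConnected
  have hC : (𝒟₁.metric.restrict PseudoRiemannianMetric.contMDiff_restrict_holds U).IsCauchyHypersurface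
      (𝒟₁.timeOrientation.restrict PseudoRiemannianMetric.contMDiff_restrict_holds
        𝒟₁.timeOrientation.contMDiff_restrict_holds U) (range (𝒟₁.embedOpens U hU.embed_mem)) := by
    rw [𝒟₁.toDataEmbedding.range_embedOpens U hU.embed_mem]
    exact hU.isCauchyHypersurface
  exact ⟨𝒟₁.restrict U hconn hU.embed_mem hν hC, 𝒟₁.restrict_embedsInto U hconn hU.embed_mem hν hC,
    hU.restrict_embedsInto hconn hν hC⟩

/-- **The item from the absolute programme's local-theory input, the domain of dependence and the
relative "no corresponding boundary points" theorem** — `subdataDevelopmentsEmbed_of_localTheory_of_cauchyRegion_of_ncb`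
with `hloc` in the realised shape `hlocal` of `MGHDExistenceReduction.lean`
(`hloc_of_isCommonDevelopment`). [cite: Sbierski2016AHP, Thm. 2.4(ii), Thm. 3.5 and §3.3] -/
theorem subdataDevelopmentsEmbed_of_isCommonDevelopment_of_cauchyRegion_of_ncb
    (hlocal : ∀ (N : Type) [TopologicalSpace N] [ChartedSpace E3 N] [IsManifold (𝓡 3) ∞ N]
      [ConnectedSpace N] (D₁ : InitialDataSet (𝓡 3) N) (𝒟₁ 𝒟₂ : VacuumCauchyDevelopment D₁),
      ∃ U : Opens 𝒟₁.carrier, 𝒟₁.toCauchyDevelopment.IsCommonDevelopment 𝒟₂.toDataEmbedding U)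
    (hc : ∀ (X : Type) [TopologicalSpace X] [ChartedSpace E3 X] [IsManifold (𝓡 3) ∞ X]
      [T2Space X] [SecondCountableTopology X] [ConnectedSpace X] (D : InitialDataSet (𝓡 3) X)
      (𝒟 : VacuumCauchyDevelopment D) (N : Type) [TopologicalSpace N] [ChartedSpace E3 N]
      [IsManifold (𝓡 3) ∞ N] [ConnectedSpace N] (Φ : N → X)
      (hΦ : ContMDiff (𝓡 3) (𝓡 3) (∞ + 1) Φ) (hΦ' : ∀ u, Injective (mfderiv (𝓡 3) (𝓡 3) Φ u)),
      IsOpenEmbedding Φ →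
      ∃ V : Opens 𝒟.carrier, IsConnected (V : Set 𝒟.carrier) ∧ (∀ u, 𝒟.embed (Φ u) ∈ V) ∧
        (𝒟.metric.restrict PseudoRiemannianMetric.contMDiff_restrict_holds V).IsCauchyHypersurface
          (𝒟.timeOrientation.restrict PseudoRiemannianMetric.contMDiff_restrict_holds
            𝒟.timeOrientation.contMDiff_restrict_holds V) (Subtype.val ⁻¹' range (𝒟.embed ∘ Φ)))
    (hncb : ∀ (X : Type) [TopologicalSpace X] [ChartedSpace E3 X] [IsManifold (𝓡 3) ∞ X]
      [T2Space X] [SecondCountableTopology X] [ConnectedSpace X] (D : InitialDataSet (𝓡 3) X)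
      (𝒟 : VacuumCauchyDevelopment D), 𝒟.IsMaximal →
      ∀ (N : Type) [TopologicalSpace N] [ChartedSpace E3 N] [IsManifold (𝓡 3) ∞ N]
      [ConnectedSpace N] (Φ : N → X) (hΦ : ContMDiff (𝓡 3) (𝓡 3) (∞ + 1) Φ)
      (hΦ' : ∀ u, Injective (mfderiv (𝓡 3) (𝓡 3) Φ u)), IsOpenEmbedding Φ →
      ∀ (𝒟' : VacuumCauchyDevelopment (D.comap Φ hΦ hΦ')) (U : Opens 𝒟'.carrier)
        (ψ : 𝒟'.carrier → 𝒟.carrier),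
        ((∀ u, 𝒟'.embed u ∈ U) ∧ IsConnected (U : Set 𝒟'.carrier) ∧
        (𝒟'.metric.restrict PseudoRiemannianMetric.contMDiff_restrict_holds U).IsCauchyHypersurface
          (𝒟'.timeOrientation.restrict PseudoRiemannianMetric.contMDiff_restrict_holds
            𝒟'.timeOrientation.contMDiff_restrict_holds U) (Subtype.val ⁻¹' range 𝒟'.embed) ∧
        ContMDiffOn (𝓡 4) (𝓡 4) ∞ ψ U ∧
        (∀ p ∈ U, pullbackBilin (I := 𝓡 4) (I' := 𝓡 4) ψ 𝒟.metric.val p = 𝒟'.metric.val p) ∧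
        (∀ p ∈ U, 𝒟.timeOrientation.IsFutureDirected
          (mfderiv (𝓡 4) (𝓡 4) ψ p (𝒟'.timeOrientation.vectorField p))) ∧
        ψ ∘ 𝒟'.embed = 𝒟.embed ∘ Φ) →
        (∀ (U' : Opens 𝒟'.carrier) (ψ' : 𝒟'.carrier → 𝒟.carrier),
          ((∀ u, 𝒟'.embed u ∈ U') ∧ IsConnected (U' : Set 𝒟'.carrier) ∧
          (𝒟'.metric.restrict PseudoRiemannianMetric.contMDiff_restrict_holds
              U').IsCauchyHypersurface
            (𝒟'.timeOrientation.restrict PseudoRiemannianMetric.contMDiff_restrict_holds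
              𝒟'.timeOrientation.contMDiff_restrict_holds U') (Subtype.val ⁻¹' range 𝒟'.embed) ∧
          ContMDiffOn (𝓡 4) (𝓡 4) ∞ ψ' U' ∧
          (∀ p ∈ U', pullbackBilin (I := 𝓡 4) (I' := 𝓡 4) ψ' 𝒟.metric.val p = 𝒟'.metric.val p) ∧
          (∀ p ∈ U', 𝒟.timeOrientation.IsFutureDirected
            (mfderiv (𝓡 4) (𝓡 4) ψ' p (𝒟'.timeOrientation.vectorField p))) ∧
          ψ' ∘ 𝒟'.embed = 𝒟.embed ∘ Φ) →
          U ≤ U' → EqOn ψ ψ' U → U' = U) →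
        ∀ p ∈ frontier (U : Set 𝒟'.carrier), ∀ q : 𝒟.carrier,
          ¬ ClusterPt q (map ψ (𝓝[(U : Set 𝒟'.carrier)] p))) :
    Summit.FinalStateConjecture.FinalStateConjecture.Theses.SwallowTheDatum.SubdataDevelopmentsEmbed :=
  subdataDevelopmentsEmbed_of_localTheory_of_cauchyRegion_of_ncb (hloc_of_isCommonDevelopment hlocal)
    hc hncb

/-! ### Local uniqueness from the registered named fact -/

/-- **Hypothesis `hloc` of the skeletons from the registered statement of local geometric
uniqueness** (`Literature.Geometry.Lorentzian.hawkingEllis_locallyUnique_vacuumDevelopment`,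
`Literature/Geometry/Lorentzian/CauchyProblemLocalUniqueness.lean`; Hawking–Ellis 1973, §7.5,
pp. 248–249; Sbierski 2016, Thm. 2.4 (ii)): the data manifold `N` of a Cauchy development is
Hausdorff and second countable (it is embedded in the spacetime by `ι`), so the statement applies
to it. [cite: HawkingEllis1973CUP, §7.5, pp. 248–249] -/
theorem hloc_of_locallyUnique (h : hawkingEllis_locallyUnique_vacuumDevelopment)
    (N : Type) [TopologicalSpace N] [ChartedSpace E3 N] [IsManifold (𝓡 3) ∞ N]
    [ConnectedSpace N] (D₁ : InitialDataSet (𝓡 3) N) (𝒟₁ 𝒟₂ : VacuumCauchyDevelopment D₁) :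
    ∃ 𝒰 : VacuumCauchyDevelopment D₁,
      𝒰.toCauchyDevelopment.EmbedsInto 𝒟₁.toCauchyDevelopment ∧
        𝒰.toCauchyDevelopment.EmbedsInto 𝒟₂.toCauchyDevelopment := by
  haveI : T2Space N := 𝒟₁.isSmoothEmbedding.isEmbedding.t2Space
  haveI : SecondCountableTopology N := 𝒟₁.isSmoothEmbedding.isEmbedding.secondCountableTopology
  exact h N D₁ 𝒟₁ 𝒟₂

/-! ### With the registered local-uniqueness fact -/

/-- **`SubdataDevelopmentsEmbed` from the named fact of local geometric uniqueness, the domain of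
dependence and the relative "no corresponding boundary points" theorem** — the reduction
`subdataDevelopmentsEmbed_of_localTheory_of_cauchyRegion_of_ncb` with (a) supplied by the
registered Literature statement `hawkingEllis_locallyUnique_vacuumDevelopment`
(`Literature/Geometry/Lorentzian/CauchyProblemLocalUniqueness.lean`; Hawking–Ellis 1973, §7.5,
pp. 248–249; Sbierski 2016, Thm. 2.4 (ii)) via `hloc_of_locallyUnique`. What remains displayed is
causal theory: (b) `hc` and (c) `hncb`. [cite: HawkingEllis1973CUP, §7.5, pp. 248–249 and §7.6, p. 250] -/
theorem subdataDevelopmentsEmbed_of_locallyUnique_of_cauchyRegion_of_ncb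
    (h : hawkingEllis_locallyUnique_vacuumDevelopment)
    (hc : ∀ (X : Type) [TopologicalSpace X] [ChartedSpace E3 X] [IsManifold (𝓡 3) ∞ X]
      [T2Space X] [SecondCountableTopology X] [ConnectedSpace X] (D : InitialDataSet (𝓡 3) X)
      (𝒟 : VacuumCauchyDevelopment D) (N : Type) [TopologicalSpace N] [ChartedSpace E3 N]
      [IsManifold (𝓡 3) ∞ N] [ConnectedSpace N] (Φ : N → X)
      (hΦ : ContMDiff (𝓡 3) (𝓡 3) (∞ + 1) Φ) (hΦ' : ∀ u, Injective (mfderiv (𝓡 3) (𝓡 3) Φ u)),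
      IsOpenEmbedding Φ →
      ∃ V : Opens 𝒟.carrier, IsConnected (V : Set 𝒟.carrier) ∧ (∀ u, 𝒟.embed (Φ u) ∈ V) ∧
        (𝒟.metric.restrict PseudoRiemannianMetric.contMDiff_restrict_holds V).IsCauchyHypersurface
          (𝒟.timeOrientation.restrict PseudoRiemannianMetric.contMDiff_restrict_holds
            𝒟.timeOrientation.contMDiff_restrict_holds V) (Subtype.val ⁻¹' range (𝒟.embed ∘ Φ)))
    (hncb : ∀ (X : Type) [TopologicalSpace X] [ChartedSpace E3 X] [IsManifold (𝓡 3) ∞ X]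
      [T2Space X] [SecondCountableTopology X] [ConnectedSpace X] (D : InitialDataSet (𝓡 3) X)
      (𝒟 : VacuumCauchyDevelopment D), 𝒟.IsMaximal →
      ∀ (N : Type) [TopologicalSpace N] [ChartedSpace E3 N] [IsManifold (𝓡 3) ∞ N]
      [ConnectedSpace N] (Φ : N → X) (hΦ : ContMDiff (𝓡 3) (𝓡 3) (∞ + 1) Φ)
      (hΦ' : ∀ u, Injective (mfderiv (𝓡 3) (𝓡 3) Φ u)), IsOpenEmbedding Φ →
      ∀ (𝒟' : VacuumCauchyDevelopment (D.comap Φ hΦ hΦ')) (U : Opens 𝒟'.carrier)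
        (ψ : 𝒟'.carrier → 𝒟.carrier),
        ((∀ u, 𝒟'.embed u ∈ U) ∧ IsConnected (U : Set 𝒟'.carrier) ∧
        (𝒟'.metric.restrict PseudoRiemannianMetric.contMDiff_restrict_holds U).IsCauchyHypersurface
          (𝒟'.timeOrientation.restrict PseudoRiemannianMetric.contMDiff_restrict_holds
            𝒟'.timeOrientation.contMDiff_restrict_holds U) (Subtype.val ⁻¹' range 𝒟'.embed) ∧
        ContMDiffOn (𝓡 4) (𝓡 4) ∞ ψ U ∧
        (∀ p ∈ U, pullbackBilin (I := 𝓡 4) (I' := 𝓡 4) ψ 𝒟.metric.val p = 𝒟'.metric.val p) ∧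
        (∀ p ∈ U, 𝒟.timeOrientation.IsFutureDirected
          (mfderiv (𝓡 4) (𝓡 4) ψ p (𝒟'.timeOrientation.vectorField p))) ∧
        ψ ∘ 𝒟'.embed = 𝒟.embed ∘ Φ) →
        (∀ (U' : Opens 𝒟'.carrier) (ψ' : 𝒟'.carrier → 𝒟.carrier),
          ((∀ u, 𝒟'.embed u ∈ U') ∧ IsConnected (U' : Set 𝒟'.carrier) ∧
          (𝒟'.metric.restrict PseudoRiemannianMetric.contMDiff_restrict_holds
              U').IsCauchyHypersurface
            (𝒟'.timeOrientation.restrict PseudoRiemannianMetric.contMDiff_restrict_holds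
              𝒟'.timeOrientation.contMDiff_restrict_holds U') (Subtype.val ⁻¹' range 𝒟'.embed) ∧
          ContMDiffOn (𝓡 4) (𝓡 4) ∞ ψ' U' ∧
          (∀ p ∈ U', pullbackBilin (I := 𝓡 4) (I' := 𝓡 4) ψ' 𝒟.metric.val p = 𝒟'.metric.val p) ∧
          (∀ p ∈ U', 𝒟.timeOrientation.IsFutureDirected
            (mfderiv (𝓡 4) (𝓡 4) ψ' p (𝒟'.timeOrientation.vectorField p))) ∧
          ψ' ∘ 𝒟'.embed = 𝒟.embed ∘ Φ) →
          U ≤ U' → EqOn ψ ψ' U → U' = U) →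
        ∀ p ∈ frontier (U : Set 𝒟'.carrier), ∀ q : 𝒟.carrier,
          ¬ ClusterPt q (map ψ (𝓝[(U : Set 𝒟'.carrier)] p))) :
    Summit.FinalStateConjecture.FinalStateConjecture.Theses.SwallowTheDatum.SubdataDevelopmentsEmbed :=
  subdataDevelopmentsEmbed_of_localTheory_of_cauchyRegion_of_ncb (hloc_of_locallyUnique h) hc hncb

end Summit.FinalStateConjecture.FinalStateConjecture.Theorems

end
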